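import Summits.KontsevichZagierPeriods.KontsevichZagierPeriods.Theses.IsogenyCertificates
import Summits.KontsevichZagierPeriods.KontsevichZagierPeriods.Theses.SymplecticScissors
import Summits.KontsevichZagierPeriods.KontsevichZagierPeriods.Theorems.XMapKernel.Negative.Core
import Summits.KontsevichZagierPeriods.KontsevichZagierPeriods.Theorems.IsogenyCertificatesXMapKernelIffSummit
import Summits.KontsevichZagierPeriods.KontsevichZagierPeriods.Theorems.IsogenyCertificatesAlgebraicModuliRealPeriodCell
import Summits.KontsevichZagierPeriods.KontsevichZagierPeriods.Theorems.IsogenyCertificatesXMapPeriodTransfer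
import Summits.KontsevichZagierPeriods.KontsevichZagierPeriods.Theorems.IsogenyCertificatesGenusTwoRealPeriodCellOfHuberWustholz
import Summits.KontsevichZagierPeriods.KontsevichZagierPeriods.Theorems.SymplecticScissorsRealOnePeriodRelationsConditional
import Literature.NumberTheory.Transcendental.KZRelationsLE
import Literature.NumberTheory.Transcendental.KZCalculusProofs
import Literature.NumberTheory.Transcendental.CurvePeriods

/-!
# Strategist certificate r3 — crux `XMapKernelOfCells` (stmt-KontsevichZagierPeriods-18976) MODULO Huber–Wüstholz

Seat `cstrat-stmt-KontsevichZagierPeriods-18976` (planner-of-record, 2026-08-17 ~09:10Z), companion of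
`Cruxes/XMapKernelOfCells/STRATEGY-CENSUS.md` (census r3). Kernel-checked, no `sorry`.

What landed between census r2 (07:28Z) and this pass, and is USED here:
* `BiellipticRealPeriodCell` PROVED (`BiellipticRealPeriodCellLine.BiellipticRealPeriodCell_proof`, ef2f090c) — not
  even needed below (`G → B` is closure monotonicity);
* `FermatIsogeny.BetaLinearSector.M₁_le_relations` (the typed Green generator is a move chain, unconditional);
* `SymplecticScissors.RealOnePeriodRelations.realOnePeriodRelations_of_huberWustholzCurvePeriods :
  HuberWustholzCurvePeriods → RealOnePeriodRelations` (crux stmt-10042 modulo its apex);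
* `IsogenyCertificates.GenusTwoRealPeriodCellLine.genusTwoRealPeriodCell_of_huberWustholzCurvePeriods :
  HuberWustholzCurvePeriods → GenusTwoRealPeriodCell` (crux stmt-17657 modulo the same apex, 08:54Z).

Consequences certified in this file (HW := the named Literature fact `HuberWustholzCurvePeriods`, Huber–Wüstholz 2022
Thm 13.3 (2), a THEOREM IN PRINT carried cite-only by the tree):
* §2 `remainder_iff_summit_of_HW : HW → (XMapKernelOfCells ↔ KontsevichZagierPeriods)` — **the crux is the summit modulo a
  published theorem**; unconditionally `XMapKernelOfCells → HW → KontsevichZagierPeriods` and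
  `KontsevichZagierPeriods → XMapKernelOfCells`; every OTHER binder of the route's `closes` holds modulo HW
  (`closes_binders_of_HW`), so the route's residual is literally Conjecture 1.
* §3 `headCell_one_of_HW : HW → HeadCell 1` — Conjecture 1 on ALL representations of ambient dimension ≤ 1 (the whole
  Huber–Wüstholz sector, dimension-0 constants included via one Newton–Leibniz slab) holds modulo HW; hence the PRICES of
  census r2 are now PAID: `HW → (Cofinal 1 ↔ S)`, `HW → (AdjoinedKernel 1 ↔ S)`, `HW → (XMapKernelOfCells ↔ Cofinal 1)` —
  the dimension seam has collapsed onto the summit: every split of the crux headed by a dimension-one sector has a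
  summit-equivalent tail modulo HW (criterion (c) fails E1-mod-HW, no longer "in waiting").
* §4 schema: modulo HW the crux may be replaced by the summit inside ANY decomposition
  (`split_iff_of_HW`), so a decomposition of `XMapKernelOfCells` is a decomposition of `KontsevichZagierPeriods`.

Vocabulary `CellKernel` / `HeadCell` / `Cofinal` / `AdjoinedKernel` copied verbatim from `Seams.lean` (Cruxes files are not
library modules). Nothing here concludes a route decl except from hypotheses that are the summit, HW, or pieces.
-/

noncomputable section

set_option linter.dupNamespace false

namespace Summit.KontsevichZagierPeriods.KontsevichZagierPeriods.Cruxes.XMapKernelOfCells.ModHW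

open Literature.NumberTheory.Transcendental
open Summit.KontsevichZagierPeriods.KontsevichZagierPeriods.Theses.IsogenyCertificates
open Summit.KontsevichZagierPeriods.XMapKernel.Negative
open Summit.KontsevichZagierPeriods.IsogenyCertificates
open Summit.KontsevichZagierPeriods.SymplecticScissors.RealOnePeriodRelationsNegative (H₁ M₁)

/-! ## §0 Vocabulary -/

/-- The apex: Huber–Wüstholz 2022 Thm 13.3 (2), as the tree's named fact. -/
abbrev HW : Prop := Literature.NumberTheory.Transcendental.HuberWustholzCurvePeriods

/-- The sibling crux stmt-10042 (route SymplecticScissors): Huber–Wüstholz in real clothes. -/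
abbrev ROPR : Prop := Summit.KontsevichZagierPeriods.KontsevichZagierPeriods.Theses.SymplecticScissors.RealOnePeriodRelations

/-- Conjecture 1 in kernel form on a sector `S ≤ FormalRep`. -/
def CellKernel (S : AddSubgroup KZ.FormalRep) : Prop :=
  ∀ c ∈ S, KZ.eval c = 0 → c ∈ KZ.relations

/-- The dimension-`≤ d` sector (ambient dimension of the motive). -/
def HeadCell (d : ℕ) : Prop := CellKernel (KZ.formalRepLE d)

/-- The bridge tail of the dimension seam. -/
def Cofinal (d : ℕ) : Prop := HeadCell d → XMapKernel

/-- Kernel elements of dimension `≤ d`. -/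
def kerLE (d : ℕ) : Set KZ.FormalRep := {c | c ∈ KZ.formalRepLE d ∧ KZ.eval c = 0}

/-- Conjecture 1 with all `≤ d`-dimensional period relations adjoined as axioms. -/
def AdjoinedKernel (d : ℕ) : Prop :=
  ∀ c : KZ.FormalRep, KZ.eval c = 0 → c ∈ AddSubgroup.closure ((moves : Set KZ.FormalRep) ∪ kerLE d)

theorem xMapKernel_iff_kernel : XMapKernel ↔ ∀ c : KZ.FormalRep, KZ.eval c = 0 → c ∈ KZ.relations := by
  rw [crux_iff, XMapKernelIffSummit.closure_gens_eq_relations_holds]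

theorem kernel_iff_summit : (∀ c : KZ.FormalRep, KZ.eval c = 0 → c ∈ KZ.relations) ↔ _root_.KontsevichZagierPeriods :=
  xMapKernel_iff_kernel.symm.trans XMapKernelIffSummit.xMapKernel_iff_summit

theorem eval_eq_zero_of_mem_relations {c : KZ.FormalRep} (hc : c ∈ KZ.relations) : KZ.eval c = 0 :=
  AddMonoidHom.mem_ker.1 (KZ.relations_le_ker_eval_holds hc)

/-! ## §1 The cells modulo HW -/

/-- `A` is a theorem of the tree (p144507). -/
theorem cellA_holds : AlgebraicModuliRealPeriodCell := AlgRealPeriodCell.AlgebraicModuliRealPeriodCell_of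

/-- `T` is a theorem of the tree (cd95a2da). -/
theorem transfer_holds : XMapPeriodTransfer := XMapPeriodTransferCells.XMapPeriodTransfer_of

/-- `G → B` (closure monotonicity, `F := G ∘ X²`). -/
theorem bielliptic_of_genusTwo : GenusTwoRealPeriodCell → BiellipticRealPeriodCell := by
  intro hG c hc h0
  refine hG c (AddSubgroup.closure_mono ?_ hc) h0
  rintro d ⟨G, q, a₀, a₁, r, hdeg, hsq, hpos, -, hdom, hint, rfl⟩
  refine ⟨G.comp (Polynomial.X ^ 2), q, a₀, a₁, r, hsq, Or.inr ?_, hpos, hdom, hint, rfl⟩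
  rw [Polynomial.natDegree_comp, hdeg, Polynomial.natDegree_X_pow]

/-- **`HW → G`** (landed 2026-08-17 08:54Z). -/
theorem genusTwo_of_HW (h : HW) : GenusTwoRealPeriodCell :=
  GenusTwoRealPeriodCellLine.genusTwoRealPeriodCell_of_huberWustholzCurvePeriods h

/-- `ROPR → G` (landed with it). -/
theorem genusTwo_of_ropr (h : ROPR) : GenusTwoRealPeriodCell :=
  GenusTwoRealPeriodCellLine.genusTwoRealPeriodCell_of_realOnePeriodRelations h

/-- **Every binder of the route's `closes` except the remainder holds modulo HW.** -/
theorem closes_binders_of_HW (h : HW) :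
    XMapPeriodTransfer ∧ AlgebraicModuliRealPeriodCell ∧ GenusTwoRealPeriodCell ∧ BiellipticRealPeriodCell :=
  ⟨transfer_holds, cellA_holds, genusTwo_of_HW h, bielliptic_of_genusTwo (genusTwo_of_HW h)⟩

/-! ## §2 The crux modulo HW: it is the summit -/

/-- Unconditionally (census r2): the crux is Conjecture 1 relative to the genus-two sector. -/
theorem remainder_iff_genusTwo_imp_summit :
    XMapKernelOfCells ↔ (GenusTwoRealPeriodCell → _root_.KontsevichZagierPeriods) :=
  ⟨fun h hG => XMapKernelIffSummit.xMapKernel_iff_summit.1 (h cellA_holds hG (bielliptic_of_genusTwo hG)),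
    fun h _ hG _ => XMapKernelIffSummit.xMapKernel_iff_summit.2 (h hG)⟩

/-- The summit gives the crux (never stronger than S). -/
theorem remainder_of_summit : _root_.KontsevichZagierPeriods → XMapKernelOfCells :=
  fun hs _ _ _ => XMapKernelIffSummit.xMapKernel_iff_summit.2 hs

/-- Given the genus-two cell, crux and summit coincide. -/
theorem remainder_iff_summit_of_genusTwo (hG : GenusTwoRealPeriodCell) :
    XMapKernelOfCells ↔ _root_.KontsevichZagierPeriods :=
  ⟨fun h => remainder_iff_genusTwo_imp_summit.1 h hG, remainder_of_summit⟩

/-- Given the sibling crux stmt-10042, crux and summit coincide. -/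
theorem remainder_iff_summit_of_ropr (h : ROPR) : XMapKernelOfCells ↔ _root_.KontsevichZagierPeriods :=
  remainder_iff_summit_of_genusTwo (genusTwo_of_ropr h)

/-- **MAIN. Modulo the published theorem HW (Huber–Wüstholz 2022, Thm 13.3 (2)) the crux IS the summit.** -/
theorem remainder_iff_summit_of_HW (h : HW) : XMapKernelOfCells ↔ _root_.KontsevichZagierPeriods :=
  remainder_iff_summit_of_genusTwo (genusTwo_of_HW h)

/-- Unconditional reading: a proof of the crux is a proof of the period conjecture from Huber–Wüstholz. -/
theorem summit_of_remainder_of_HW : XMapKernelOfCells → HW → _root_.KontsevichZagierPeriods :=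
  fun hR h => (remainder_iff_summit_of_HW h).1 hR

/-- The route's deciding theorem read modulo HW: its residual is Conjecture 1 itself. -/
theorem route_residual_iff_summit_of_HW (h : HW) :
    (XMapPeriodTransfer → AlgebraicModuliRealPeriodCell → GenusTwoRealPeriodCell → BiellipticRealPeriodCell →
      XMapKernelOfCells → _root_.KontsevichZagierPeriods) ∧ (XMapKernelOfCells ↔ _root_.KontsevichZagierPeriods) :=
  ⟨fun _ _ hG _ hR => (remainder_iff_summit_of_genusTwo hG).1 hR, remainder_iff_summit_of_HW h⟩

/-! ## §3 The whole dimension-one sector modulo HW, and the collapse of the dimension seam -/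

/-- Every combination of ambient dimension `≤ 1` is congruent modulo `KZ.relations` to a combination of
representations of dimension EXACTLY one (lift each dimension-0 constant by one Newton–Leibniz slab). -/
theorem exists_H₁_congr (c : KZ.FormalRep) (hc : c ∈ KZ.formalRepLE 1) :
    ∃ c' ∈ H₁, c - c' ∈ KZ.relations := by
  refine AddSubgroup.closure_induction (p := fun c _ => ∃ c' ∈ H₁, c - c' ∈ KZ.relations) ?_ ?_ ?_ ?_ hc
  · rintro x ⟨k, s, hk, rfl⟩
    rcases Nat.le_one_iff_eq_zero_or_eq_one.mp hk with rfl | rfl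
    · obtain ⟨R, hR⟩ := s.exists_equivalent_of_le (show 0 ≤ 1 from Nat.zero_le 1)
      exact ⟨KZ.of R, AddSubgroup.subset_closure ⟨R, rfl⟩, hR⟩
    · exact ⟨KZ.of s, AddSubgroup.subset_closure ⟨s, rfl⟩, by simp⟩
  · exact ⟨0, zero_mem _, by simp⟩
  · rintro x y - - ⟨x', hx', hxr⟩ ⟨y', hy', hyr⟩
    refine ⟨x' + y', add_mem hx' hy', ?_⟩
    have e : x + y - (x' + y') = (x - x') + (y - y') := by abel
    rw [e]
    exact add_mem hxr hyr
  · rintro x - ⟨x', hx', hxr⟩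
    refine ⟨-x', neg_mem hx', ?_⟩
    have e : -x - -x' = -(x - x') := by abel
    rw [e]
    exact neg_mem hxr

/-- **`ROPR → HeadCell 1`**: the sibling crux stmt-10042 (with the landed Green glue) IS Conjecture 1 on the whole
dimension-`≤ 1` sector of the calculus. -/
theorem headCell_one_of_ropr (hR : ROPR) : HeadCell 1 := by
  intro c hc h0
  obtain ⟨c', hc', hcc'⟩ := exists_H₁_congr c hc
  have h0' : KZ.eval c' = 0 := by
    have := eval_eq_zero_of_mem_relations hcc'
    rwa [map_sub, h0, zero_sub, neg_eq_zero] at this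
  have hsplit : c = (c - c') + c' := by abel
  rw [hsplit]
  exact add_mem hcc' (GenusTwoRealPeriodCellLine.kernel_le_relations_of_realOnePeriodRelations hR hc' h0')

/-- **`HW → HeadCell 1`**: modulo Huber–Wüstholz, Conjecture 1 holds for ALL combinations of representations of ambient
dimension `≤ 1` — every elementary real 1-period of the calculus, all genera, complete or not, logarithms, π. -/
theorem headCell_one_of_HW (h : HW) : HeadCell 1 :=
  headCell_one_of_ropr
    (Summit.KontsevichZagierPeriods.SymplecticScissors.RealOnePeriodRelations.realOnePeriodRelations_of_huberWustholzCurvePeriods h)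

theorem headCell_of_summit (d : ℕ) : _root_.KontsevichZagierPeriods → HeadCell d :=
  fun hs c _ h0 => kernel_iff_summit.2 hs c h0

theorem cofinal_of_summit (d : ℕ) : _root_.KontsevichZagierPeriods → Cofinal d :=
  fun hs _ => XMapKernelIffSummit.xMapKernel_iff_summit.2 hs

/-- Price of the bridge split `HeadCell d ∧ Cofinal d` (census r2 S4): with the head, the tail is the summit. -/
theorem cofinal_iff_summit_of_headCell (d : ℕ) (hH : HeadCell d) : Cofinal d ↔ _root_.KontsevichZagierPeriods :=
  ⟨fun hC => XMapKernelIffSummit.xMapKernel_iff_summit.1 (hC hH), cofinal_of_summit d⟩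

/-- **The price is now paid modulo HW: the tail `Cofinal 1` of the dimension-one bridge IS the summit.** -/
theorem cofinal_one_iff_summit_of_HW (h : HW) : Cofinal 1 ↔ _root_.KontsevichZagierPeriods :=
  cofinal_iff_summit_of_headCell 1 (headCell_one_of_HW h)

/-- … and the crux, the tail and the summit are one statement modulo HW. -/
theorem remainder_iff_cofinal_one_of_HW (h : HW) : XMapKernelOfCells ↔ Cofinal 1 :=
  (remainder_iff_summit_of_HW h).trans (cofinal_one_iff_summit_of_HW h).symm

theorem relations_le_closure_adjoined (d : ℕ) :
    KZ.relations ≤ AddSubgroup.closure ((moves : Set KZ.FormalRep) ∪ kerLE d) := by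
  rw [relations_eq_closure_moves]
  exact AddSubgroup.closure_mono Set.subset_union_left

theorem closure_adjoined_eq_relations_of_headCell (d : ℕ) (hH : HeadCell d) :
    AddSubgroup.closure ((moves : Set KZ.FormalRep) ∪ kerLE d) = KZ.relations := by
  refine le_antisymm ?_ (relations_le_closure_adjoined d)
  rw [AddSubgroup.closure_le]
  rintro c (hc | ⟨hc, h0⟩)
  · rw [relations_eq_closure_moves]
    exact AddSubgroup.subset_closure hc
  · exact hH c hc h0

theorem adjoined_of_summit (d : ℕ) : _root_.KontsevichZagierPeriods → AdjoinedKernel d :=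
  fun hs c h0 => relations_le_closure_adjoined d (kernel_iff_summit.2 hs c h0)

/-- Price of the adjoined split (census r2 S4′): with the head, `AdjoinedKernel d` is the summit. -/
theorem adjoined_iff_summit_of_headCell (d : ℕ) (hH : HeadCell d) : AdjoinedKernel d ↔ _root_.KontsevichZagierPeriods := by
  refine ⟨fun hK => kernel_iff_summit.1 fun c h0 => ?_, adjoined_of_summit d⟩
  rw [← closure_adjoined_eq_relations_of_headCell d hH]
  exact hK c h0

/-- **Paid modulo HW: "Conjecture 1 with every 1-period relation as an axiom" IS the summit.** -/
theorem adjoined_one_iff_summit_of_HW (h : HW) : AdjoinedKernel 1 ↔ _root_.KontsevichZagierPeriods :=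
  adjoined_iff_summit_of_headCell 1 (headCell_one_of_HW h)

/-- Any sector cell is a consequence of the summit; hence modulo HW every sector-headed split
`CellKernel S ∧ (CellKernel S → XMapKernelOfCells)` with `S` INSIDE dimension one has BOTH pieces decided:
the head holds (sub-cell of `HeadCell 1`) and the tail is the summit. -/
theorem sectorSplit_below_seam_of_HW (h : HW) {S : AddSubgroup KZ.FormalRep} (hS : S ≤ KZ.formalRepLE 1) :
    CellKernel S ∧ ((CellKernel S → XMapKernelOfCells) ↔ _root_.KontsevichZagierPeriods) := by
  have hH : CellKernel S := fun c hc h0 => headCell_one_of_HW h c (hS hc) h0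
  refine ⟨hH, ⟨fun ht => (remainder_iff_summit_of_HW h).1 (ht hH), fun hs _ => remainder_of_summit hs⟩⟩

/-! ## §4 Schema: modulo HW the crux is interchangeable with the summit in any decomposition -/

/-- For any proposition `P` (a candidate co-piece), `P → X` and `P → S` agree modulo HW, and so do `X ∧ P` and `S ∧ P`:
a decomposition of the crux is a decomposition of the period conjecture. -/
theorem split_iff_of_HW (h : HW) (P : Prop) :
    ((P → XMapKernelOfCells) ↔ (P → _root_.KontsevichZagierPeriods)) ∧
      ((XMapKernelOfCells ∧ P) ↔ (_root_.KontsevichZagierPeriods ∧ P)) :=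
  ⟨imp_congr Iff.rfl (remainder_iff_summit_of_HW h), and_congr (remainder_iff_summit_of_HW h) Iff.rfl⟩

/-- The negation side modulo HW: refuting the crux is refuting the period conjecture (and conversely). -/
theorem not_remainder_iff_not_summit_of_HW (h : HW) : ¬ XMapKernelOfCells ↔ ¬ _root_.KontsevichZagierPeriods :=
  not_congr (remainder_iff_summit_of_HW h)

end Summit.KontsevichZagierPeriods.KontsevichZagierPeriods.Cruxes.XMapKernelOfCells.ModHW

end
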